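import Summits.BirchSwinnertonDyer.BirchSwinnertonDyer.Theorems.KolyvaginRoadThreePointCertificate
import Summits.BirchSwinnertonDyer.BirchSwinnertonDyer.Theorems.KolyvaginRoadThreeLevelData
import Summits.BirchSwinnertonDyer.Rank1Residual.X11b.KolyvaginHpointsAssembly
import Literature.NumberTheory.EllipticCurves.McCallum1991.HigherLevelKolyvaginClasses
import HarnessLib

/-!
# T1 JET (cell `bsd-jet`), road K: the ORDER of the concrete Kolyvagin class `c_M(n)` from the exact
# `p`-divisibility depth of `P_n` — McCallum 1991, p. 305: *"the class `c_M(n)` has order `p^{M−M_r}`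
# if and only if `p^{M_r} ∥ P_n`"* — and the S7 inputs `hordκ` / `hκ0` of
# `JET.tamagawaExponent_le_mInfty_of_rowData` DISCHARGED in the row objects' currency

HONEST FRAMING (programme file §HONESTY, verbatim): «no tranche here proves BSD; ARM L moves the
LITERAL column of an r ≤ 1 census into the kernel-proved-modulo-named-print column.» THEOREMS ONLY
(seat `bsd-jet-pv-2`, session g3; `--supports stmt-BirchSwinnertonDyer-14418`, helper); 0 classes
move. WHAT THIS IS: the stub **S7** of sheet `PV2-J6-KERNEL.md` §2 ([J] §3.1 items 6–7 /
§4.1.4: `κ_{c,m} = p^{m(c)} κ̃`, `ord κ̃ = m`, i.e. `ord c_m(c) = p^{m − m(c)}`) for the tree's CONCRETE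
classes `KolyvaginHeegnerData.kolyvaginClass`, from the cocycle algebra of
`HeegnerPointsKolyvaginPrimaryClassesProofs` (`cls_zsmul`, `cls_eq_zero_iff`) and the Galois descent
`E(K̄)^{Gal(K̄/K[n])} = E(K[n])` of `KolyCert` (`KolyvaginRoadThreeClassCertificate`):
* `zsmul_kolyvaginClass_eq_zero_iff` — on the admissible / invariant branch, `j • c_M(n) = 0` iff
  `p^M ∣ j • P_n` in `E(K[n])` (McCallum Cor. 4.5 applied to `j P_n`);
* `addOrderOf_kolyvaginClass_of_exactDepth` — `p^u ∥ P_n`, `u ≤ M` ⟹ `ord c_M(n) = p^{M−u}`;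
  `kolyvaginClass_ne_zero_of_exactDepth` (`u < M`); `_of_surj` variants with the admissibility input
  SUPPLIED by `RingClassNoTorsion.isAdmissible_pointsSubgroup` (Gross Lemma 4.3, `ρ̄_{E,p}` onto, `p` odd)
  and the invariance input SUPPLIED by `KolyCert.toGeomPoints_derivedPoint_mem_invPoints_of_dvd_zhang`
  (McCallum (4) / Gross Prop. 3.6) given data at the divisors;
* `exists_datum_exactDepth_of_m_eq` / `exists_datum_addOrderOf_kolyvaginClass_of_m_eq` — in the
  currency of the `H63` binder of `jetchevDivisibilityCarrierMult_of_prop52_of_coreVertexExistence'`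
  (`mdiv`, `m` characterised over all data, `m c = m_∞ < k`): a datum `d` of conductor `c` with
  `p^{m_∞} ∥ P_c` EXISTS, and its class `c_k(c)` has order `p^{k − m_∞}` (hence is non-zero) — the
  hypotheses `hordκ`, `hκ0` of `JET.tamagawaExponent_le_mInfty_of_rowData` (p492296), modulo the two
  CM facts of Gross 1991 §3 that make Kolyvagin–Heegner data exist at the divisors of `c`
  (`phi_heegnerPointOfConductor_mem_range_map_ringClassField`, `exists_generator_ringClassGalOver`,
  consumed through `nonempty_kolyvaginHeegnerData_of_grossCM`).
References: [cite: McCallumLMS1991, §4 (4)–(6), Cor. 4.5; §5 p. 303 (ord_p P_n) and proof of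
Prop. 5.2 (p. 305: "c_M(n) has order p^{M−M_r} iff p^{M_r} ∥ P_n")]
[cite: GrossLMS1991, §3 Prop. 3.6, §4 (4.1)–(4.4), Lemma 4.3, Prop. 4.7 (1)]
[cite: Jetchev2008, §4.1.4 (p. 818) and §5.2, proof of Thm. 5.2 (p. 822: "κ_{c,m} = p^{m(c)} κ̃")].
-/

set_option autoImplicit false

noncomputable section

open scoped Classical

open WeierstrassCurve Field NumberField IsDedekindDomain
  Literature.NumberTheory.EllipticCurves Literature.NumberTheory.EllipticCurves.ModularForms
  Literature.NumberTheory.EllipticCurves.KolyvaginCocycle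
  Summit.BirchSwinnertonDyer.Rank1Residual.X11b
  Summit.BirchSwinnertonDyer.Rank1Residual.X11b.Three

namespace Summit.BirchSwinnertonDyer.Rank1Residual.JET

-- `K : Type`: the tree's ring-class class field theory is universe `0`.
variable {K : Type} [Field K] [NumberField K] {N : ℕ} [NeZero N] {W : WeierstrassCurve ℚ}
  {Dt : ModularParametrizationData W N} {β : ℤ} {ι : K →+* ℂ} {n : ℕ}

/-! ## §1 `j • c_M(n)` is the class of `j • P_n`; vanishing criterion -/

/-- Cast bookkeeping: `((p^(a+b) : ℕ) : ℤ) = ((p^a : ℕ) : ℤ) * ((p^b : ℕ) : ℤ)`. [folklore] -/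
theorem natCast_pow_add_eq_mul (p a b : ℕ) :
    ((p ^ (a + b) : ℕ) : ℤ) = ((p ^ a : ℕ) : ℤ) * ((p ^ b : ℕ) : ℤ) := by
  push_cast; ring

/-- **McCallum's Cor. 4.5 for the multiple `j • P_n`**: for a Kolyvagin–Heegner datum `d` of conductor
`n ≠ 0` over an imaginary quadratic `K`, on the standing inputs of the cocycle (`hA`: `E(K[n]) ⊆ E(K̄)`
admissible for `p^M`; `hP`: `[P_n]` `Γ_K`-invariant mod `p^M`), `j • c_M(n) = 0` iff
`j • P_n ∈ p^M E(K[n])`. (`j • c_M(n)` is McCallum's class of `j • P_n` by `cls_zsmul`; then Gross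
Prop. 4.7 (1) / McCallum Cor. 4.5 at `N = Gal(K̄/K[n])`, `A = E(K[n])`, exactly as
`KolyCert.kolyvaginClass_eq_zero_iff_pDiv`.) [cite: McCallumLMS1991, §4 (6), Cor. 4.5]
[cite: GrossLMS1991, Prop. 4.7 (1)] -/
theorem zsmul_kolyvaginClass_eq_zero_iff (d : KolyvaginHeegnerData Dt β ι n) {p : ℕ} (hp : p.Prime)
    (M : ℕ) (hA : IsAdmissible (absoluteGaloisGroup K) d.pointsSubgroup ((p ^ M : ℕ) : ℤ))
    (hP : d.toGeomPoints d.derivedPoint ∈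
      invPoints (absoluteGaloisGroup K) d.pointsSubgroup ((p ^ M : ℕ) : ℤ)) (j : ℤ) :
    j • d.kolyvaginClass hp M = 0 ↔
      ∃ Q : (W.baseChange (ringClassField K ι n)).toAffine.Point,
        ((p ^ M : ℕ) : ℤ) • Q = j • d.derivedPoint := by
  have hdiv := (W.baseChange K).zsmul_geomPoints_surjective_of_charZero
    (n := ((p ^ M : ℕ) : ℤ)) (by exact_mod_cast pow_ne_zero M hp.ne_zero)
  obtain ⟨Q₀, hQ₀⟩ := hdiv (d.toGeomPoints d.derivedPoint)
  simp only at hQ₀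
  have hjP : j • d.toGeomPoints d.derivedPoint ∈
      invPoints (absoluteGaloisGroup K) d.pointsSubgroup ((p ^ M : ℕ) : ℤ) :=
    AddSubgroup.zsmul_mem _ hP j
  have hjQ : ((p ^ M : ℕ) : ℤ) • (j • Q₀) = j • d.toGeomPoints d.derivedPoint := by
    rw [smul_comm, hQ₀]
  rw [d.kolyvaginClass_of_admissible hp M hA hP, kolyvaginClass_eq_cls hA hP hQ₀,
    ← cls_zsmul hA (continuous_smul_geomPoints _) hP hQ₀ j hjP hjQ,
    cls_eq_zero_iff hA _ hjP hjQ
      (N := {g : absoluteGaloisGroup K | ∀ x : ringClassField K ι n,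
        (show AlgebraicClosure K ≃ₐ[K] AlgebraicClosure K from g) (d.emb x) = d.emb x})
      (fun g hg ↦ by
        rw [← map_zsmul]
        exact KolyCert.smul_toGeomPoints_of_forall_emb d g hg _)
      (fun v hv ↦ KolyCert.mem_pointsSubgroup_of_forall_smul_eq d v fun g hg ↦ hv g hg)]
  constructor
  · rintro ⟨_, ⟨Q, rfl⟩, hQ⟩
    refine ⟨Q, Affine.Point.map_injective (W' := W) d.emb.toRatAlgHom ?_⟩
    change d.toGeomPoints (((p ^ M : ℕ) : ℤ) • Q) = d.toGeomPoints (j • d.derivedPoint)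
    rw [map_zsmul, map_zsmul]
    exact hQ
  · rintro ⟨Q, hQ⟩
    exact ⟨d.toGeomPoints Q, ⟨Q, rfl⟩, by rw [← map_zsmul, hQ, map_zsmul]⟩

/-- `p^M`-torsion-freeness of `E(K[n])` read off the admissibility input: `p^i • Q = 0` with `i ≤ M`
forces `Q = 0`. [folklore] -/
theorem eq_zero_of_pow_zsmul_eq_zero_of_isAdmissible (d : KolyvaginHeegnerData Dt β ι n) {p : ℕ}
    (M : ℕ) (hA : IsAdmissible (absoluteGaloisGroup K) d.pointsSubgroup ((p ^ M : ℕ) : ℤ))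
    {i : ℕ} (hi : i ≤ M) (Q : (W.baseChange (ringClassField K ι n)).toAffine.Point)
    (hQ : ((p ^ i : ℕ) : ℤ) • Q = 0) : Q = 0 := by
  have hQM : ((p ^ M : ℕ) : ℤ) • Q = 0 := by
    obtain ⟨r, hr⟩ := Nat.exists_eq_add_of_le hi
    rw [hr, add_comm, natCast_pow_add_eq_mul, mul_smul, hQ, smul_zero]
  have h0 : d.toGeomPoints Q = 0 :=
    hA.eq_zero_of_zsmul ⟨Q, rfl⟩ (by rw [← map_zsmul, hQM, map_zero])
  exact Affine.Point.map_injective (W' := W) d.emb.toRatAlgHom (by rw [map_zero]; exact h0)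

/-! ## §2 The order of `c_M(n)` from `p^u ∥ P_n` -/

/-- **`p^u ∥ P_n` with `u ≤ M` ⟹ `c_M(n)` has order exactly `p^{M−u}`** (McCallum 1991, proof of
Prop. 5.2, p. 305: *"the class `c_M(n)` has order `p^{M−M_r}` if and only if `p^{M_r} ∥ P_n`"*; Jetchev
2008, §4.1.4 / §5.2: `κ_{c,m} = p^{m(c)} κ̃_{c,m}` with `ord κ̃ = m`), on the standing inputs `hA`
(admissibility) and `hP` (invariance). Proof: `p^{M−u} • c_M(n)` is the class of
`p^{M−u} P_n = p^M (P_n / p^u)`, so vanishes; if `M−u ≥ 1`, `p^{M−u−1} • c_M(n) = 0` would give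
`p^{M−1} (P_n/p^u) ∈ p^M E(K[n])`, hence (no `p`-torsion) `P_n/p^u ∈ p E(K[n])`, contradicting
`p^{u+1} ∤ P_n`. [cite: McCallumLMS1991, §5, proof of Prop. 5.2 (p. 305)]
[cite: Jetchev2008, §4.1.4 (p. 818), proof of Thm. 5.2 (p. 822)] -/
theorem addOrderOf_kolyvaginClass_of_exactDepth (d : KolyvaginHeegnerData Dt β ι n) {p : ℕ}
    (hp : p.Prime) {M u : ℕ} (hu : u ≤ M)
    (hA : IsAdmissible (absoluteGaloisGroup K) d.pointsSubgroup ((p ^ M : ℕ) : ℤ))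
    (hP : d.toGeomPoints d.derivedPoint ∈
      invPoints (absoluteGaloisGroup K) d.pointsSubgroup ((p ^ M : ℕ) : ℤ))
    (hdvd : ∃ Q : (W.baseChange (ringClassField K ι n)).toAffine.Point,
      ((p ^ u : ℕ) : ℤ) • Q = d.derivedPoint)
    (hndvd : ¬ ∃ Q : (W.baseChange (ringClassField K ι n)).toAffine.Point,
      ((p ^ (u + 1) : ℕ) : ℤ) • Q = d.derivedPoint) :
    addOrderOf (d.kolyvaginClass hp M) = p ^ (M - u) := by
  haveI : Fact p.Prime := ⟨hp⟩
  obtain ⟨Q, hQ⟩ := hdvd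
  -- `p^{M-u} • c = 0`
  have hkill : (p ^ (M - u)) • d.kolyvaginClass hp M = 0 := by
    rw [← natCast_zsmul, (zsmul_kolyvaginClass_eq_zero_iff d hp M hA hP _)]
    refine ⟨Q, ?_⟩
    rw [← hQ, smul_smul, ← natCast_pow_add_eq_mul, Nat.sub_add_cancel hu]
  rcases Nat.eq_zero_or_pos (M - u) with h0 | hpos
  · -- `u = M`: the class is `0`
    rw [h0, pow_zero] at hkill ⊢
    rw [one_nsmul] at hkill
    rw [hkill, addOrderOf_zero]
  · obtain ⟨r, hr⟩ : ∃ r, M - u = r + 1 := ⟨M - u - 1, by omega⟩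
    rw [hr] at hkill ⊢
    refine addOrderOf_eq_prime_pow (fun habs ↦ hndvd ?_) hkill
    -- `p^r • c = 0` gives `p^M ∣ p^r P_n`, i.e. `p^{M-1} Q ∈ p^M E(K[n])`
    rw [← natCast_zsmul, zsmul_kolyvaginClass_eq_zero_iff d hp M hA hP _] at habs
    obtain ⟨Q', hQ'⟩ := habs
    -- `p^r • P = p^(r+u) • Q` and `r + u + 1 = M`
    have hru : r + u + 1 = M := by omega
    have hp1 : ((p ^ 1 : ℕ) : ℤ) = (p : ℤ) := by rw [pow_one]
    have h1 : ((p ^ (r + u) : ℕ) : ℤ) • (Q - ((p ^ 1 : ℕ) : ℤ) • Q') = 0 := by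
      rw [smul_sub, smul_smul, ← natCast_pow_add_eq_mul, hru, hQ', ← hQ, smul_smul,
        ← natCast_pow_add_eq_mul, sub_self]
    have h2 : Q - ((p ^ 1 : ℕ) : ℤ) • Q' = 0 :=
      eq_zero_of_pow_zsmul_eq_zero_of_isAdmissible d M hA (by omega) _ h1
    refine ⟨Q', ?_⟩
    rw [← hQ, (sub_eq_zero.mp h2), smul_smul, ← natCast_pow_add_eq_mul]

/-- **`p^u ∥ P_n` with `u < M` ⟹ `c_M(n) ≠ 0`** (its order `p^{M−u}` exceeds `1`); in particular the
class is then NOT the junk value of `KolyvaginHeegnerData.kolyvaginClass`.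
[cite: McCallumLMS1991, §5, proof of Prop. 5.2 (p. 305)] -/
theorem kolyvaginClass_ne_zero_of_exactDepth (d : KolyvaginHeegnerData Dt β ι n) {p : ℕ}
    (hp : p.Prime) {M u : ℕ} (hu : u < M)
    (hA : IsAdmissible (absoluteGaloisGroup K) d.pointsSubgroup ((p ^ M : ℕ) : ℤ))
    (hP : d.toGeomPoints d.derivedPoint ∈
      invPoints (absoluteGaloisGroup K) d.pointsSubgroup ((p ^ M : ℕ) : ℤ))
    (hdvd : ∃ Q : (W.baseChange (ringClassField K ι n)).toAffine.Point,
      ((p ^ u : ℕ) : ℤ) • Q = d.derivedPoint)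
    (hndvd : ¬ ∃ Q : (W.baseChange (ringClassField K ι n)).toAffine.Point,
      ((p ^ (u + 1) : ℕ) : ℤ) • Q = d.derivedPoint) :
    d.kolyvaginClass hp M ≠ 0 :=
  McCallum1991.kolyvaginClass_ne_zero_of_addOrderOf_eq hp hu
    (addOrderOf_kolyvaginClass_of_exactDepth d hp hu.le hA hP hdvd hndvd)

/-- Converse direction (divisibility half): if `c_M(n)` has order `p^{M−u}` with `u ≤ M` (on the
admissible / invariant branch) then `p^u ∣ P_n` in `E(K[n])` — `p^{M−u} • c_M(n) = 0` gives
`p^{M−u} P_n = p^M Q'`, and `E(K[n])` has no `p`-torsion. [cite: McCallumLMS1991, §5 (p. 305)] -/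
theorem pow_dvd_derivedPoint_of_addOrderOf_kolyvaginClass (d : KolyvaginHeegnerData Dt β ι n) {p : ℕ}
    (hp : p.Prime) {M u : ℕ} (hu : u ≤ M)
    (hA : IsAdmissible (absoluteGaloisGroup K) d.pointsSubgroup ((p ^ M : ℕ) : ℤ))
    (hP : d.toGeomPoints d.derivedPoint ∈
      invPoints (absoluteGaloisGroup K) d.pointsSubgroup ((p ^ M : ℕ) : ℤ))
    (hord : addOrderOf (d.kolyvaginClass hp M) = p ^ (M - u)) :
    ∃ Q : (W.baseChange (ringClassField K ι n)).toAffine.Point,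
      ((p ^ u : ℕ) : ℤ) • Q = d.derivedPoint := by
  have hkill : (((p ^ (M - u) : ℕ) : ℤ)) • d.kolyvaginClass hp M = 0 := by
    rw [natCast_zsmul, ← hord, addOrderOf_nsmul_eq_zero]
  obtain ⟨Q', hQ'⟩ := (zsmul_kolyvaginClass_eq_zero_iff d hp M hA hP _).mp hkill
  -- `p^M Q' = p^{M-u} P`, so `p^{M-u} (p^u Q' - P) = 0`, hence `p^u Q' = P`
  refine ⟨Q', ?_⟩
  have h1 : ((p ^ (M - u) : ℕ) : ℤ) • (((p ^ u : ℕ) : ℤ) • Q' - d.derivedPoint) = 0 := by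
    rw [smul_sub, smul_smul, ← natCast_pow_add_eq_mul, Nat.sub_add_cancel hu, hQ', sub_self]
  exact sub_eq_zero.mp (eq_zero_of_pow_zsmul_eq_zero_of_isAdmissible d M hA (Nat.sub_le M u) _ h1)

/-! ## §3 The standing inputs SUPPLIED: `ρ̄_{E,p}` onto (`hA`), data at the divisors (`hP`) -/

/-- **`ord c_M(n) = p^{M−u}` from `p^u ∥ P_n`, with BOTH standing inputs supplied**: admissibility
from `ρ̄_{E,p}` onto at an odd `p` (`RingClassNoTorsion.isAdmissible_pointsSubgroup`, Gross Lemma 4.3)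
and the invariance of `[P_n]` mod `p^M` from McCallum's (4) / Gross Prop. 3.6 for concrete data
(`KolyCert.toGeomPoints_derivedPoint_mem_invPoints_of_dvd_zhang`: `K` imaginary quadratic with
`(N, d_K) = 1`, `d_K < −4`, `n` a square-free product of Kolyvagin primes of index `≥ M`, data given at
every divisor of `n`, `d = data n`). [cite: McCallumLMS1991, §4 (4)–(5), §5 (p. 305)]
[cite: GrossLMS1991, Prop. 3.6, Lemma 4.3] -/
theorem addOrderOf_kolyvaginClass_of_exactDepth_of_surj [W.IsElliptic] [W.IsGloballyMinimal]
    (hK : IsImaginaryQuadratic K) (hND : IsCoprime (N : ℤ) (NumberField.discr K))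
    (hD : NumberField.discr K < -4) {p : ℕ} (hp : p.Prime) (hp2 : p ≠ 2)
    (hρ : W.HasSurjectiveModNGaloisRep p) {M u : ℕ} (hu : u ≤ M) (hn : Squarefree n)
    (hkol : ∀ q ∈ n.primeFactors,
      Zhang2014.IsKolyvaginPrime N W K p q ∧ M ≤ Zhang2014.kolyvaginIndex W p q)
    (data : (m : ℕ) → m ∣ n → KolyvaginHeegnerData Dt β ι m)
    (hdvd : ∃ Q : (W.baseChange (ringClassField K ι n)).toAffine.Point,
      ((p ^ u : ℕ) : ℤ) • Q = (data n dvd_rfl).derivedPoint)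
    (hndvd : ¬ ∃ Q : (W.baseChange (ringClassField K ι n)).toAffine.Point,
      ((p ^ (u + 1) : ℕ) : ℤ) • Q = (data n dvd_rfl).derivedPoint) :
    addOrderOf ((data n dvd_rfl).kolyvaginClass hp M) = p ^ (M - u) :=
  addOrderOf_kolyvaginClass_of_exactDepth _ hp hu
    (RingClassNoTorsion.isAdmissible_pointsSubgroup _ hK hn.ne_zero hp hp2 hρ M)
    (KolyCert.toGeomPoints_derivedPoint_mem_invPoints_of_dvd_zhang hK ι Dt hp hND hD hn hkol data n
      dvd_rfl)
    hdvd hndvd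

/-! ## §4 The S7 inputs of `JET.tamagawaExponent_le_mInfty_of_rowData` in the `H63` binder's currency -/

/-- **A datum realising the exact depth `m_∞` at a conductor with `m(c) = m_∞`.** In the currency of the
`H63` binder (`jetchevDivisibilityCarrier{Mult,Ne,Add}_of_prop52_of_coreVertexExistence'`): `mdiv c`
characterised by `u ≤ mdiv c ↔ ∀ data d of conductor c, p^u ∣ P_c^{(d)}`, `m c = mdiv c` if
`mdiv c < M(c)` and `⊤` otherwise; if `m c = m_∞` (finite) then `mdiv c = m_∞ < M(c)` and some datum
`d` of conductor `c` has `p^{m_∞} ∥ P_c^{(d)}` (every datum has `p^{m_∞} ∣ P_c`; not every datum has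
`p^{m_∞+1} ∣ P_c`). Elementary (`ℕ∞` bookkeeping). [cite: Jetchev2008, §4.1.4 (p. 818: m'(c), m(c))] -/
theorem exists_datum_exactDepth_of_m_eq [W.IsGloballyMinimal] [NeZero (W.conductorNorm ℤ)] {p : ℕ}
    (Dt : ModularParametrizationData W (W.conductorNorm ℤ)) (β : ℤ) (ι : K →+* ℂ)
    (mdiv m : {c : ℕ // Squarefree c ∧ ∀ ℓ ∈ c.primeFactors,
        Zhang2014.IsKolyvaginPrime (W.conductorNorm ℤ) W K p ℓ} → ℕ∞)
    (hmdiv : ∀ c (u : ℕ), (u : ℕ∞) ≤ mdiv c ↔ ∀ d : KolyvaginHeegnerData Dt β ι c.1,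
      ∃ Q : (W.baseChange (ringClassField K ι c.1)).toAffine.Point,
        ((p ^ u : ℕ) : ℤ) • Q = d.derivedPoint)
    (hm : ∀ c, m c = if mdiv c < Zhang2014.levelIndex W p c.1 then mdiv c else ⊤)
    (c : {c : ℕ // Squarefree c ∧ ∀ ℓ ∈ c.primeFactors,
        Zhang2014.IsKolyvaginPrime (W.conductorNorm ℤ) W K p ℓ})
    (mInf : ℕ) (hmc : m c = mInf) :
    mdiv c = mInf ∧ (mInf : ℕ∞) < Zhang2014.levelIndex W p c.1 ∧
      ∃ d : KolyvaginHeegnerData Dt β ι c.1,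
        (∃ Q : (W.baseChange (ringClassField K ι c.1)).toAffine.Point,
          ((p ^ mInf : ℕ) : ℤ) • Q = d.derivedPoint) ∧
        ¬ ∃ Q : (W.baseChange (ringClassField K ι c.1)).toAffine.Point,
          ((p ^ (mInf + 1) : ℕ) : ℤ) • Q = d.derivedPoint := by
  have hmc' := hm c
  rw [hmc] at hmc'
  have hlt : mdiv c < Zhang2014.levelIndex W p c.1 := by
    by_contra h
    rw [if_neg h] at hmc'
    exact ENat.coe_ne_top _ hmc'
  rw [if_pos hlt] at hmc'
  have hmdc : mdiv c = mInf := hmc'.symm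
  refine ⟨hmdc, hmdc ▸ hlt, ?_⟩
  have hall : ∀ d : KolyvaginHeegnerData Dt β ι c.1,
      ∃ Q : (W.baseChange (ringClassField K ι c.1)).toAffine.Point,
        ((p ^ mInf : ℕ) : ℤ) • Q = d.derivedPoint := (hmdiv c mInf).mp (by rw [hmdc])
  have hnot : ¬ ∀ d : KolyvaginHeegnerData Dt β ι c.1,
      ∃ Q : (W.baseChange (ringClassField K ι c.1)).toAffine.Point,
        ((p ^ (mInf + 1) : ℕ) : ℤ) • Q = d.derivedPoint := by
    intro h
    have h' := (hmdiv c (mInf + 1)).mpr h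
    rw [hmdc] at h'
    exact absurd (ENat.coe_le_coe.mp h') (by omega)
  push Not at hnot
  obtain ⟨d, hd⟩ := hnot
  exact ⟨d, hall d, fun ⟨Q, hQ⟩ ↦ hd Q hQ⟩

/-- **`hordκ` and `hκ0` of `JET.tamagawaExponent_le_mInfty_of_rowData` DISCHARGED (modulo the two CM
facts of Gross 1991 §3 that make data exist at the divisors)** in the `H63` binder's currency: under
`E/ℚ` globally minimal with `ρ̄_{E,p}` onto at an odd `p`, `K` imaginary quadratic with
`d_K ∉ {−3, −4}` and the Heegner hypothesis for `N = N_E`, a frame `(Dt, β, ι)`, `mdiv`/`m` as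
characterised, a conductor `c ∈ Λ` with `m c = m_∞`, and a level `k` with `m_∞ < k` and `k ≤ M(c)`:
there is a datum `d` of conductor `c` with `p^{m_∞} ∥ P_c^{(d)}`, `ord c_k(c) = p^{k − m_∞}` and
`c_k(c) ≠ 0`. The admissibility is Gross Lemma 4.3 (`RingClassNoTorsion.isAdmissible_pointsSubgroup`),
the invariance McCallum (4) for concrete data (`KolyCert.toGeomPoints_derivedPoint_mem_invPoints_of_dvd_zhang`)
fed with data at every divisor of `c` (`nonempty_kolyvaginHeegnerData_of_grossCM` from the named facts
`phi_heegnerPointOfConductor_mem_range_map_ringClassField` and `exists_generator_ringClassGalOver`).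
[cite: McCallumLMS1991, §5, proof of Prop. 5.2 (p. 305)] [cite: GrossLMS1991, §3 (pp. 238–239),
Prop. 3.6, Lemma 4.3] [cite: Jetchev2008, §4.1.4 (p. 818), proof of Thm. 5.2 (p. 822)] -/
theorem exists_datum_addOrderOf_kolyvaginClass_of_m_eq [W.IsElliptic] [W.IsGloballyMinimal]
    [NeZero (W.conductorNorm ℤ)]
    (hCM1 : phi_heegnerPointOfConductor_mem_range_map_ringClassField (W.conductorNorm ℤ) W K)
    (hCM2 : exists_generator_ringClassGalOver K)
    (hK : IsImaginaryQuadratic K) (hD3 : NumberField.discr K ≠ -3) (hD4 : NumberField.discr K ≠ -4)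
    (hH : SatisfiesHeegnerHypothesis (W.conductorNorm ℤ) K)
    {p : ℕ} [Fact p.Prime] (hp2 : p ≠ 2) (hρ : W.HasSurjectiveModNGaloisRep p)
    (Dt : ModularParametrizationData W (W.conductorNorm ℤ)) (β : ℤ) (ι : K →+* ℂ)
    (mdiv m : {c : ℕ // Squarefree c ∧ ∀ ℓ ∈ c.primeFactors,
        Zhang2014.IsKolyvaginPrime (W.conductorNorm ℤ) W K p ℓ} → ℕ∞)
    (hmdiv : ∀ c (u : ℕ), (u : ℕ∞) ≤ mdiv c ↔ ∀ d : KolyvaginHeegnerData Dt β ι c.1,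
      ∃ Q : (W.baseChange (ringClassField K ι c.1)).toAffine.Point,
        ((p ^ u : ℕ) : ℤ) • Q = d.derivedPoint)
    (hm : ∀ c, m c = if mdiv c < Zhang2014.levelIndex W p c.1 then mdiv c else ⊤)
    (c : {c : ℕ // Squarefree c ∧ ∀ ℓ ∈ c.primeFactors,
        Zhang2014.IsKolyvaginPrime (W.conductorNorm ℤ) W K p ℓ})
    (mInf k : ℕ) (hmc : m c = mInf) (hik : mInf < k)
    (hkc : (k : ℕ∞) ≤ Zhang2014.levelIndex W p c.1) :
    ∃ d : KolyvaginHeegnerData Dt β ι c.1,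
      (∃ Q : (W.baseChange (ringClassField K ι c.1)).toAffine.Point,
        ((p ^ mInf : ℕ) : ℤ) • Q = d.derivedPoint) ∧
      (¬ ∃ Q : (W.baseChange (ringClassField K ι c.1)).toAffine.Point,
        ((p ^ (mInf + 1) : ℕ) : ℤ) • Q = d.derivedPoint) ∧
      addOrderOf (d.kolyvaginClass (Fact.out : p.Prime) k) = p ^ (k - mInf) ∧
      d.kolyvaginClass (Fact.out : p.Prime) k ≠ 0 := by
  have hp : p.Prime := Fact.out
  obtain ⟨-, -, d, hdvd, hndvd⟩ := exists_datum_exactDepth_of_m_eq Dt β ι mdiv m hmdiv hm c mInf hmc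
  have hND : IsCoprime (W.conductorNorm ℤ : ℤ) (NumberField.discr K) :=
    KolyvaginAssembly.isCoprime_discr_of_satisfiesHeegnerHypothesis hK hH
  have hD : NumberField.discr K < -4 := KolyvaginAssembly.discr_lt_neg_four hK ⟨hD3, hD4⟩
  have hkol : ∀ q ∈ c.1.primeFactors, Zhang2014.IsKolyvaginPrime (W.conductorNorm ℤ) W K p q ∧
      k ≤ Zhang2014.kolyvaginIndex W p q := fun q hq ↦
    ⟨c.2.2 q hq, Zhang2014.natCast_le_levelIndex_iff.mp hkc q hq⟩
  have hinert : ∀ (m' : ℕ), m' ∣ c.1 → ∀ q ∈ m'.primeFactors, (Ideal.span {(q : 𝓞 K)}).IsPrime :=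
    fun m' hm' q hq ↦ (c.2.2 q (Nat.primeFactors_mono hm' c.2.1.ne_zero hq)).2.2.2.2.1
  -- data at every divisor of `c` (the given `d` at `c` itself)
  have hne : ∀ m' : ℕ, m' ∣ c.1 → Nonempty (KolyvaginHeegnerData Dt β ι m') := fun m' hm' ↦
    BirchSwinnertonDyer.Theorems.nonempty_kolyvaginHeegnerData_of_grossCM hCM1 hCM2 hK hH Dt β ι
      d.dvd_sq_sub (c.2.1.squarefree_of_dvd hm') (hinert m' hm')
  let data : (m' : ℕ) → m' ∣ c.1 → KolyvaginHeegnerData Dt β ι m' := fun m' hm' ↦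
    if h : m' = c.1 then h ▸ d else (hne m' hm').some
  have hdata : data c.1 dvd_rfl = d := by simp [data]
  have hord : addOrderOf (d.kolyvaginClass hp k) = p ^ (k - mInf) := by
    have h := addOrderOf_kolyvaginClass_of_exactDepth_of_surj (Dt := Dt) (β := β) (ι := ι) hK hND hD
      hp hp2 hρ hik.le c.2.1 hkol data (by rw [hdata]; exact hdvd) (by rw [hdata]; exact hndvd)
    rwa [hdata] at h
  exact ⟨d, hdvd, hndvd, hord, McCallum1991.kolyvaginClass_ne_zero_of_addOrderOf_eq hp hik hord⟩

end Summit.BirchSwinnertonDyer.Rank1Residual.JET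

end
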